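import Literature.AlgebraicGeometry.Modules.PullbackClosedImmersionUnit
import Literature.AlgebraicGeometry.Modules.PullbackClosedImmersionCokernel
import Literature.AlgebraicGeometry.Modules.PushforwardClosedImmersionExact
import Literature.AlgebraicGeometry.Morphisms.SectionsBaseChangeSurjective
import Literature.AlgebraicGeometry.Motives.WittSchemeSpecialFibreLocus
import Literature.AlgebraicGeometry.FormalGeometry.LocallyFreeOfThickenings
import Mathlib.RingTheory.Ideal.Quotient.PowTransition
import HarnessLib

/-!
# The `p`-adic thickening tower of a `W(k)`-scheme: restriction model versus quotient model

Let `k` be a commutative ring, `W = W(k)`, `𝒳` a `W`-scheme and `X_n = 𝒳 ⊗_W W/pⁿ`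
(`WittScheme.thickening 𝒳 n`, with the closed immersions `ι_n = thickeningι 𝒳 n : X_n → 𝒳` and the
transition immersions `thickeningMap 𝒳 h : X_m → X_n`, `m ≤ n`, of `Motives/CrystallineRealization`).
Grothendieck's existence theorem for `𝒳` proper over `W(k)` (`Motives/GrothendieckExistenceWitt`,
Görtz–Wedhorn II Thm. 24.94 / Prop. 24.95) is stated in the RESTRICTION model of formal modules —
modules `E_n` on the `X_{n+1}` with isomorphisms `E_{n+1}|_{X_{n+1}} ≅ E_n` by inverse image — while
the theorem on formal functions and the existence arguments of the tree
(`Morphisms/FormalFunctionsModule*`) run in the QUOTIENT model `ℱ ↦ (ℱ/pⁿ⁺¹ℱ)_n` on `𝒳` itself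
(Görtz–Wedhorn II (24.18.1): `ℱ_{/Z} = (ℱ/𝒥ⁿ⁺¹ℱ)_n = (i_n^*ℱ)_n`). This file is the dictionary:

* the tower: `ι_n` and the transition maps are closed immersions, the squares
  `X_m → X_n` over `Spec W/pᵐ → Spec W/pⁿ` are cartesian (`isPullback_thickeningMap`), `pᵐ` dies on
  `X_m` (`appTop_thickeningι_algebraMapΓ_pow`), and a function on an affine open of `X_n` dying on
  `X_m` is a multiple of `pᵐ` (`exists_eq_mul_of_app_thickeningMap_eq_zero`, from
  `Morphisms/SectionsBaseChangeSurjective`);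
* INPUT (restriction ⇒ quotient), `pushforwardCokernelIso`: for `E` finite locally free on `X_n` and
  `e : E|_{X_m} ≅ E'`, **`(ι_{n*}E)/pᵐ(ι_{n*}E) ≅ ι_{m*}E'`** on `𝒳` (`ι_*` is exact for closed
  immersions, `Modules/PushforwardClosedImmersionExact`; `E/pᵐE ≅ j_*j^*E` for the closed immersion
  `j : X_m → X_n` cut out by `pᵐ`, `Modules/PullbackClosedImmersionUnit`); so the direct images
  `M_n = ι_{n+1*}E_n` of a formal vector bundle `(E_n)_n` form a module `(M_n, M_{n+1}/pⁿ⁺¹ ≅ M_n)` in the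
  quotient model (`pushforwardTransitionIso`);
* OUTPUT (quotient ⇒ restriction), `pullbackThickeningιIso`: for ANY `𝒪_𝒳`-module `F` and any
  `𝒪_{X_n}`-module `E`, **an isomorphism `F/pⁿF ≅ ι_{n*}E` yields `ι_n^*F ≅ E`**
  (`Modules/PullbackClosedImmersionCokernel.pullbackIsoOfCokernelIso`); with the tree's algebraic half of
  Prop. 24.95 (`FormalGeometry/LocallyFreeOfThickenings`) this turns a levelwise identification
  `F/pⁿ⁺¹F ≅ ι_{n+1*}E_n` of a finitely presented `F` on a proper `𝒳` with a formal vector bundle into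
  the conclusion of the existence theorem: `F` is a vector bundle and `ι_1^*F ≅ E_0`
  (`isVectorBundle_and_iso_of_cokernelIsos`).

Everything is proved; no named facts.

## References

* U. Görtz, T. Wedhorn, *Algebraic Geometry II: Cohomology of Schemes*, Springer Spektrum (2023),
  doi:10.1007/978-3-658-43031-3: (24.18.1), Rem. 24.86 (p. 562), Thm. 24.94, Prop. 24.95 (p. 566).
  [GortzWedhorn2023]
* The Stacks Project, Tag 08KS (Modules, Lemma 17.13.4). [StacksProject]
-/

noncomputable section

open CategoryTheory AlgebraicGeometry Limits TopologicalSpace Opposite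
open Literature.AlgebraicGeometry.Modules Literature.AlgebraicGeometry.Morphisms

universe u

namespace Literature.AlgebraicGeometry.Motives.WittScheme

variable {p : ℕ} [Fact p.Prime] {k : Type u} [CommRing k] (𝒳 : SchemeOver (WittVector p k))

/-! ## The tower `X_n = 𝒳 ⊗_W W/pⁿ` -/

/-- The closed immersion `Spec W/pⁿ → Spec W`. [folklore] -/
abbrev quotSpec (p : ℕ) [Fact p.Prime] (k : Type u) [CommRing k] (n : ℕ) :
    Spec (.of (wittQuot p k n)) ⟶ Spec (.of (WittVector p k)) :=
  Spec.map (CommRingCat.ofHom (algebraMap (WittVector p k) (wittQuot p k n)))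

/-- The transition surjection `W/pⁿ → W/pᵐ`, `m ≤ n` (the map under `thickeningMap`). [folklore] -/
abbrev quotTransition (p : ℕ) [Fact p.Prime] (k : Type u) [CommRing k] {m n : ℕ} (h : m ≤ n) :
    wittQuot p k n →+* wittQuot p k m :=
  Ideal.Quotient.factor (Ideal.pow_le_pow_right h)

/-- `X_n = 𝒳 ×_W Spec W/pⁿ` (by `rfl`). [folklore] -/
theorem thickening_left (n : ℕ) : (thickening 𝒳 n).left = pullback 𝒳.hom (quotSpec p k n) := rfl

/-- The structure map `X_n → Spec W/pⁿ` is the second projection (by `rfl`). [folklore] -/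
theorem thickening_hom (n : ℕ) : (thickening 𝒳 n).hom = pullback.snd 𝒳.hom (quotSpec p k n) := rfl

/-- `ι_n : X_n → 𝒳` is the first projection (by `rfl`). [folklore] -/
theorem thickeningι_eq (n : ℕ) : thickeningι 𝒳 n = pullback.fst 𝒳.hom (quotSpec p k n) := rfl

/-- The square `X_n → 𝒳` over `Spec W/pⁿ → Spec W` is cartesian. [folklore] -/
theorem isPullback_thickeningι (n : ℕ) :
    IsPullback (thickeningι 𝒳 n) (thickening 𝒳 n).hom 𝒳.hom (quotSpec p k n) :=
  IsPullback.of_hasPullback _ _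

/-- `ι_n : X_n → 𝒳` is a closed immersion (base change of `Spec W/pⁿ → Spec W`). [folklore] -/
instance isClosedImmersion_thickeningι (n : ℕ) : IsClosedImmersion (thickeningι 𝒳 n) :=
  MorphismProperty.pullback_fst (P := @IsClosedImmersion) _ _ (isClosedImmersion_specMap_wittQuot n)

/-- `W → W/pⁿ → W/pᵐ = W → W/pᵐ`. [folklore] -/
theorem quotTransition_comp_algebraMap {m n : ℕ} (h : m ≤ n) :
    (quotTransition p k h).comp (algebraMap (WittVector p k) (wittQuot p k n)) =
      algebraMap (WittVector p k) (wittQuot p k m) :=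
  RingHom.ext fun _ => rfl

/-- `Spec W/pᵐ → Spec W/pⁿ → Spec W = Spec W/pᵐ → Spec W`. [folklore] -/
theorem specMap_quotTransition_comp {m n : ℕ} (h : m ≤ n) :
    Spec.map (CommRingCat.ofHom (quotTransition p k h)) ≫ quotSpec p k n = quotSpec p k m := by
  rw [← Spec.map_comp, ← CommRingCat.ofHom_comp, quotTransition_comp_algebraMap]

/-- `X_m → X_n → Spec W/pⁿ = X_m → Spec W/pᵐ → Spec W/pⁿ`. [folklore] -/
@[reassoc]
theorem thickeningMap_hom {m n : ℕ} (h : m ≤ n) :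
    thickeningMap 𝒳 h ≫ (thickening 𝒳 n).hom =
      (thickening 𝒳 m).hom ≫ Spec.map (CommRingCat.ofHom (quotTransition p k h)) :=
  pullback.lift_snd _ _ _

/-- **The transition square is cartesian**: `X_m = X_n ×_{Spec W/pⁿ} Spec W/pᵐ` via
`thickeningMap 𝒳 h` (pasting of the cartesian squares over `Spec W/pᵐ → Spec W/pⁿ → Spec W`).
[folklore] -/
theorem isPullback_thickeningMap {m n : ℕ} (h : m ≤ n) :
    IsPullback (thickeningMap 𝒳 h) (thickening 𝒳 m).hom (thickening 𝒳 n).hom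
      (Spec.map (CommRingCat.ofHom (quotTransition p k h))) := by
  refine IsPullback.of_right ?_ (thickeningMap_hom 𝒳 h) (isPullback_thickeningι 𝒳 n)
  rw [thickeningMap_ι, specMap_quotTransition_comp]
  exact isPullback_thickeningι 𝒳 m

/-- The transition maps `X_m → X_n` are closed immersions (base change of `Spec W/pᵐ → Spec W/pⁿ`).
[folklore] -/
instance isClosedImmersion_thickeningMap {m n : ℕ} (h : m ≤ n) :
    IsClosedImmersion (thickeningMap 𝒳 h) :=
  MorphismProperty.of_isPullback (P := @IsClosedImmersion) (isPullback_thickeningMap 𝒳 h).flip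
    (IsClosedImmersion.spec_of_surjective _
      (Ideal.Quotient.factor_surjective (Ideal.pow_le_pow_right h)))

/-- `ker (W/pⁿ → W/pᵐ) = (pᵐ)`. [folklore] -/
theorem ker_quotTransition {m n : ℕ} (h : m ≤ n) :
    RingHom.ker (quotTransition p k h) = Ideal.span {(p : wittQuot p k n) ^ m} := by
  rw [quotTransition, Ideal.Quotient.factor_ker, Ideal.map_pow, Ideal.map_span, Set.image_singleton,
    map_natCast]
  exact Ideal.span_singleton_pow (p : wittQuot p k n) m

/-! ## The functions `pᵐ` on the tower -/

/-- For a commutative square `i ≫ f = t ≫ Spec φ` of schemes over rings: `i♯(f♯(x)) = t♯(φ(x))` on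
global sections (`algebraMapΓ` of `Morphisms/FormalFunctions`). [folklore] -/
theorem appTop_algebraMapΓ_eq_of_comp_eq {A B : Type u} [CommRing A] [CommRing B] (φ : A →+* B)
    {X Y : Scheme.{u}} (f : X ⟶ Spec (.of A)) {i : Y ⟶ X} {t : Y ⟶ Spec (.of B)}
    (w : i ≫ f = t ≫ Spec.map (CommRingCat.ofHom φ)) (x : A) :
    i.appTop (algebraMapΓ f x) = algebraMapΓ t (φ x) := by
  change (f.appTop ≫ i.appTop) ((Scheme.ΓSpecIso (.of A)).inv x) =
    t.appTop ((Scheme.ΓSpecIso (.of B)).inv (φ x))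
  rw [← Scheme.Hom.comp_appTop, w, Scheme.Hom.comp_appTop]
  change t.appTop (((Scheme.ΓSpecIso (.of A)).inv ≫ (Spec.map (CommRingCat.ofHom φ)).appTop) x) = _
  rw [← Scheme.ΓSpecIso_inv_naturality]
  rfl

/-- `ι_n♯(pᵐ) = pᵐ` computed on `X_n → Spec W/pⁿ`: the global function `f♯(x)` of `𝒳` restricts on
`X_n` to the global function `x mod pⁿ` of the `W/pⁿ`-scheme `X_n`. [folklore] -/
theorem appTop_thickeningι_algebraMapΓ (n : ℕ) (x : WittVector p k) :
    (thickeningι 𝒳 n).appTop (algebraMapΓ 𝒳.hom x) =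
      algebraMapΓ (thickening 𝒳 n).hom (algebraMap (WittVector p k) (wittQuot p k n) x) :=
  appTop_algebraMapΓ_eq_of_comp_eq _ 𝒳.hom (isPullback_thickeningι 𝒳 n).w x

/-- **`pⁿ` dies on `X_n`**: `ι_n♯(pⁿ) = 0`. [folklore] -/
theorem appTop_thickeningι_algebraMapΓ_pow (n : ℕ) :
    (thickeningι 𝒳 n).appTop (algebraMapΓ 𝒳.hom ((p : WittVector p k) ^ n)) = 0 := by
  rw [appTop_thickeningι_algebraMapΓ, Ideal.Quotient.algebraMap_eq]
  have h0 : Ideal.Quotient.mk (Ideal.span {(p : WittVector p k)} ^ n) ((p : WittVector p k) ^ n) = 0 :=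
    Ideal.Quotient.eq_zero_iff_mem.mpr
      (Ideal.pow_mem_pow (Ideal.subset_span (Set.mem_singleton _)) n)
  rw [h0, map_zero]

/-- `pᵐ` dies on `X_m` already as a function on `X_n`: `(X_m → X_n)♯(ι_n♯(pᵐ)) = 0`. [folklore] -/
theorem appTop_thickeningMap_appTop_pow {m n : ℕ} (h : m ≤ n) :
    (thickeningMap 𝒳 h).appTop
      ((thickeningι 𝒳 n).appTop (algebraMapΓ 𝒳.hom ((p : WittVector p k) ^ m))) = 0 := by
  change ((thickeningι 𝒳 n).appTop ≫ (thickeningMap 𝒳 h).appTop)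
    (algebraMapΓ 𝒳.hom ((p : WittVector p k) ^ m)) = 0
  rw [← Scheme.Hom.comp_appTop, thickeningMap_ι]
  exact appTop_thickeningι_algebraMapΓ_pow 𝒳 m

/-- `ι_n♯(pᵐ)` is the global function `pᵐ` of the `W/pⁿ`-scheme `X_n`. [folklore] -/
theorem appTop_thickeningι_algebraMapΓ_pow_eq {m n : ℕ} :
    (thickeningι 𝒳 n).appTop (algebraMapΓ 𝒳.hom ((p : WittVector p k) ^ m)) =
      algebraMapΓ (thickening 𝒳 n).hom ((p : wittQuot p k n) ^ m) := by
  rw [appTop_thickeningι_algebraMapΓ, map_pow, map_natCast]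

/-- **A function on an affine open of `X_n` dying on `X_m` is a multiple of `pᵐ`** (the transition
square is cartesian over the surjection `W/pⁿ → W/pᵐ` with kernel `(pᵐ)`;
`Morphisms/SectionsBaseChangeSurjective.exists_eq_mul_of_app_eq_zero`), the multiple written through
the restriction of the global function `ι_n♯(pᵐ)`. [folklore] -/
theorem exists_eq_mul_of_app_thickeningMap_eq_zero {m n : ℕ} (h : m ≤ n)
    (W : (thickening 𝒳 n).left.Opens) (hW : IsAffineOpen W) (c : Γ((thickening 𝒳 n).left, W))
    (hc : ((thickeningMap 𝒳 h).app W).hom c = 0) :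
    ∃ c' : Γ((thickening 𝒳 n).left, W),
      c = (thickening 𝒳 n).left.presheaf.map (homOfLE (le_top : W ≤ ⊤)).op
        ((thickeningι 𝒳 n).appTop (algebraMapΓ 𝒳.hom ((p : WittVector p k) ^ m))) * c' := by
  rw [appTop_thickeningι_algebraMapΓ_pow_eq]
  exact exists_eq_mul_of_app_eq_zero (quotTransition p k h) (thickening 𝒳 n).hom
    (Ideal.Quotient.factor_surjective _) (ker_quotTransition h) (isPullback_thickeningMap 𝒳 h) hW c hc

/-! ## INPUT: restriction model ⇒ quotient model -/

variable {𝒳}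

/-- **`E/pᵐE ≅ j_*j^*E` on `X_n`** for the transition immersion `j : X_m → X_n` (`m ≤ n`) and `E`
finite locally free on `X_n`: the finite-locally-free case of `i_*i^*𝓕 = 𝓕/𝓘𝓕` for the closed
immersion `j`, cut out by `pᵐ` (`Modules/PullbackClosedImmersionUnit.cokernelGlobalScalarIso`).
[cite: StacksProject, Tag 08KS (Modules, Lemma 17.13.4)] -/
def cokernelPowIsoPushforwardPullback {m n : ℕ} (h : m ≤ n) {E : (thickening 𝒳 n).left.Modules}
    (hE : IsFiniteLocallyFree E) :
    cokernel (globalScalar E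
        ((thickeningι 𝒳 n).appTop (algebraMapΓ 𝒳.hom ((p : WittVector p k) ^ m)))) ≅
      (Scheme.Modules.pushforward (thickeningMap 𝒳 h)).obj
        ((Scheme.Modules.pullback (thickeningMap 𝒳 h)).obj E) :=
  cokernelGlobalScalarIso (thickeningMap 𝒳 h) hE (appTop_thickeningMap_appTop_pow 𝒳 h)
    fun W hW c hc => exists_eq_mul_of_app_thickeningMap_eq_zero 𝒳 h W hW c hc

/-- **`(ι_{n*}E)/pᵐ(ι_{n*}E) ≅ ι_{m*}E'` on `𝒳`** for `E` finite locally free on `X_n` and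
`e : E|_{X_m} ≅ E'` (`m ≤ n`): `ι_{n*}` is exact (closed immersion), so the left-hand side is
`ι_{n*}(E/pᵐE) ≅ ι_{n*}j_*j^*E ≅ ι_{n*}j_*E' = ι_{m*}E'`. This converts a module over the tower in
the restriction model (GW Def. 24.85) into its direct-image tower on `𝒳` with quotient transition
isomorphisms (the model `(ℱ/𝒥ⁿ⁺¹ℱ)_n` of (24.18.1)). [cite: GortzWedhorn2023, Def. 24.85, (24.18.1), Rem. 24.86 (pp. 561–562)] -/
def pushforwardCokernelIso {m n : ℕ} (h : m ≤ n) {E : (thickening 𝒳 n).left.Modules}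
    (hE : IsFiniteLocallyFree E) {E' : (thickening 𝒳 m).left.Modules}
    (e : (Scheme.Modules.pullback (thickeningMap 𝒳 h)).obj E ≅ E') :
    cokernel (globalScalar ((Scheme.Modules.pushforward (thickeningι 𝒳 n)).obj E)
        (algebraMapΓ 𝒳.hom ((p : WittVector p k) ^ m))) ≅
      (Scheme.Modules.pushforward (thickeningι 𝒳 m)).obj E' :=
  (pushforwardCokernelGlobalScalarIso (thickeningι 𝒳 n) E
      (algebraMapΓ 𝒳.hom ((p : WittVector p k) ^ m))).symm ≪≫
    (Scheme.Modules.pushforward (thickeningι 𝒳 n)).mapIso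
      (cokernelPowIsoPushforwardPullback h hE ≪≫
        (Scheme.Modules.pushforward (thickeningMap 𝒳 h)).mapIso e) ≪≫
    (Scheme.Modules.pushforwardComp (thickeningMap 𝒳 h) (thickeningι 𝒳 n)).app E' ≪≫
    (Scheme.Modules.pushforwardCongr (thickeningMap_ι 𝒳 h)).app E'

/-- **The direct-image tower of a formal vector bundle.** For modules `E n` on the `X_{n+1}` which are
vector bundles, with isomorphisms `E (n+1)|_{X_{n+1}} ≅ E n` (the hypotheses of
`GrothendieckExistence_vectorBundle_witt`), the direct images `M_n = ι_{n+1*}E_n` on `𝒳` carry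
isomorphisms `M_{n+1}/pⁿ⁺¹M_{n+1} ≅ M_n`. [cite: GortzWedhorn2023, Def. 24.85, (24.18.1) (pp. 561–562)] -/
def pushforwardTransitionIso (E : ∀ n : ℕ, (thickening 𝒳 (n + 1)).left.Modules)
    (hE : ∀ n, IsVectorBundle (E n))
    (e : ∀ n, (Scheme.Modules.pullback (thickeningMap 𝒳 (Nat.le_succ (n + 1)))).obj (E (n + 1)) ≅ E n)
    (n : ℕ) :
    cokernel (globalScalar ((Scheme.Modules.pushforward (thickeningι 𝒳 (n + 2))).obj (E (n + 1)))
        (algebraMapΓ 𝒳.hom ((p : WittVector p k) ^ (n + 1)))) ≅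
      (Scheme.Modules.pushforward (thickeningι 𝒳 (n + 1))).obj (E n) :=
  pushforwardCokernelIso (Nat.le_succ (n + 1)) (isFiniteLocallyFree_of_isVectorBundle (hE (n + 1)))
    (e n)

/-! ## OUTPUT: quotient model ⇒ restriction model -/

/-- **`F/pⁿF ≅ ι_{n*}E` yields `ι_n^*F ≅ E`**, for any `𝒪_𝒳`-module `F` and any `𝒪_{X_n}`-module `E`
(`ι_n^*(F/pⁿF) ≅ ι_n^*F` since `pⁿ` dies on `X_n`, and `ι_n^*ι_{n*}E ≅ E` since `ι_{n*}` is fully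
faithful; `Modules/PullbackClosedImmersionCokernel.pullbackIsoOfCokernelIso`).
[cite: GortzWedhorn2023, (24.18.1) and Rem. 24.86 (p. 562)] -/
def pullbackThickeningιIso (n : ℕ) (F : 𝒳.left.Modules) {E : (thickening 𝒳 n).left.Modules}
    (β : cokernel (globalScalar F (algebraMapΓ 𝒳.hom ((p : WittVector p k) ^ n))) ≅
      (Scheme.Modules.pushforward (thickeningι 𝒳 n)).obj E) :
    (Scheme.Modules.pullback (thickeningι 𝒳 n)).obj F ≅ E :=
  pullbackIsoOfCokernelIso (thickeningι 𝒳 n) F (appTop_thickeningι_algebraMapΓ_pow 𝒳 n) β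

/-- **From a levelwise quotient-model algebraization to the conclusion of the existence theorem.**
Let `k` be a perfect field of characteristic `p`, `𝒳 → Spec W(k)` proper, `E n` vector bundles on the
`X_{n+1}`, and `F` a finitely presented `𝒪_𝒳`-module with isomorphisms `F/pⁿ⁺¹F ≅ ι_{n+1*}E_n` for all
`n`. Then `F` is a vector bundle (its restrictions `ι_{n+1}^*F ≅ E_n` are vector bundles, and the
algebraic half of Prop. 24.95, `FormalGeometry/LocallyFreeOfThickenings`, applies) and
`ι_1^*F ≅ E_0`. [cite: GortzWedhorn2023, Thm. 24.94 and Prop. 24.95 (p. 566)] -/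
theorem isVectorBundle_and_iso_of_cokernelIsos {p : ℕ} [Fact p.Prime] {k : Type u} [Field k]
    [CharP k p] [PerfectRing k p] (𝒳 : SchemeOver (WittVector p k)) [IsProper 𝒳.hom]
    (E : ∀ n : ℕ, (thickening 𝒳 (n + 1)).left.Modules) (hE : ∀ n, IsVectorBundle (E n))
    (F : 𝒳.left.Modules) (hF : SheafOfModules.IsFinitePresentation.{u, u, u} F)
    (β : ∀ n, cokernel (globalScalar F (algebraMapΓ 𝒳.hom ((p : WittVector p k) ^ (n + 1)))) ≅
      (Scheme.Modules.pushforward (thickeningι 𝒳 (n + 1))).obj (E n)) :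
    IsVectorBundle F ∧
      Nonempty ((Scheme.Modules.pullback (thickeningι 𝒳 1)).obj F ≅ E 0) := by
  have hres : ∀ n, IsVectorBundle ((Scheme.Modules.pullback (thickeningι 𝒳 (n + 1))).obj F) :=
    fun n => (hE n).of_iso (pullbackThickeningιIso (n + 1) F (β n)).symm
  exact ⟨FormalGeometry.WittScheme.isVectorBundle_of_isVectorBundle_thickenings 𝒳 F hF hres,
    ⟨pullbackThickeningιIso 1 F (β 0)⟩⟩

end Literature.AlgebraicGeometry.Motives.WittScheme

end
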